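import Literature.MathematicalPhysics.QuantumLattice.HubbardFermiRadiusSmooth
import Mathlib.Analysis.Calculus.IteratedDeriv.Lemmas
import HarnessLib

/-!
# Curvature of the Fermi curve of the square-lattice dispersion: the convexity hypothesis
(2.8a) and the transversality hypothesis (2.8b) of Benfatto–Giuliani–Mastropietro 2003 at the
fillings of BGM 2006

Topic `Literature/MathematicalPhysics/QuantumLattice`; continues `HubbardFermiRadius.lean` and
`HubbardFermiRadiusSmooth.lean` (the polar Fermi radius `u(θ) = fermiRadius μ θ` of
`ε(k) = -2(cos k₁ + cos k₂)`, `-4 < μ < -2 - √2`, is positive, continuous, symmetric and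
real-analytic with `u' = fermiRadiusDeriv μ`).

Benfatto–Giuliani–Mastropietro's multiscale analysis of two-dimensional Fermi systems
(Ann. Henri Poincaré 4 (2003) 137, §2, hypotheses on the dispersion relation, p. 4 of the arXiv
text) assumes: "`ε(k) - μ = e` defines a regular `C^∞` convex curve `Σ(e)` encircling the origin,
which can be represented in polar coordinates as `p = u(θ,e) e_r(θ)` … moreover `u(θ,e) ≥ c > 0`
and, if `r(θ,e)` is the curvature radius, `r(θ,e)⁻¹ ≥ c > 0` (2.8a) … `0 < c₁ ≤ ∇ε(k)·e_r(θ) ≤ c₂`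
(2.8b) … `ε(k) = ε(-k)` (2.8c)", and states that the Hubbard dispersion near the band bottom is in
this class; BGM 2006 (§1 after (1.4), §2.4) use it in the form "`Σ_F^{(0)}` is a smooth convex
closed curve, symmetric around `0`" for `0 < μ_BGM < (2-√2)/2`, i.e. `-4 < μ < -2 - √2` in the
tree's convention. This file PROVES (2.8a) and (2.8b) for the level `e = 0` at every such `μ`
(each level `μ` in the open range is covered, so nearby levels are too), with explicit constants:

* §1 uniform bounds on the curve: `√(μ+4) ≤ u(θ) < π√2/4`, `(4/π)(μ+4) ≤ ∇ε·k ≤ 2u²` at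
  `k = u(θ)e_r(θ)`, hence **(2.8b)** `c₁(μ) ≤ ∇ε(p_F(θ))·e_r(θ) ≤ c₂(μ)`
  (`le_grad_dot_dir`, `grad_dot_dir_le`), and `|u'(θ)| ≤ π u³/(μ+4)`;
* §2 the second derivative `u''` (`fermiRadiusDeriv2`; `u' ∈ C^∞`);
* §3 the Cartesian parametrisation `x = u cos θ`, `y = u sin θ`, its velocity and acceleration,
  the tangency identity `∇ε(p)·p' = 0` and its derivative
  `Hess ε(p)(p',p') + ∇ε(p)·p'' = 0` (chain rule twice on `ε(p(θ)) = μ`), and the normal form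
  `½∇ε(p) = c (y', -x')` with `c = (∇ε·k)/(2u²) > 0`;
* §4 **the signed curvature** `κ(θ) = (x'y'' - y'x'')/|p'|³` of `Σ_F` traversed counterclockwise:
  the level-set formula `x'y'' - y'x'' = 2u²(cos x·x'² + cos y·y'²)/(∇ε·k)` (`cross_eq`), hence
  `κ = Hess ε(p̂', p̂')·(2u²/(∇ε·k))/|p'| > 0` and **(2.8a)**: `0 < c₁(μ) ≤ κ(θ) ≤ c₂(μ)` for all `θ`
  (`fermiCurvature_pos`, `exists_fermiCurvature_bounds`) — strict convexity of the Fermi curve with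
  curvature radius bounded above and below, from `Hess ε = 2 diag(cos k₁, cos k₂) ≥ √2` on the box
  `|kᵢ| < π/4` containing the curve.

Everything is PROVED; the definitions (`fermiRadiusDeriv2`, `fermiX/Y`, `fermiVX/VY`,
`fermiAX/AY`, `fermiCurvature`) have bodies. [folklore] computations on the explicit dispersion.

## Sources

* G. Benfatto, A. Giuliani, V. Mastropietro, *Low temperature analysis of two-dimensional Fermi
  systems with symmetric Fermi surface*, Ann. Henri Poincaré 4 (2003) 137–193, §2 (2.8a)–(2.8c)
  and §7.1 (A1.6)–(A1.7) (arXiv:cond-mat/0207210 pp. 4, 26). [BenfattoGiulianiMastropietro2003]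
* G. Benfatto, A. Giuliani, V. Mastropietro, Ann. Henri Poincaré 7 (2006) 809–898, §1 (1.4)–(1.5),
  §2.4. [BenfattoGiulianiMastropietro2006]
-/

noncomputable section

open Real Set Filter
open scoped Topology ContDiff

namespace Literature.MathematicalPhysics.QuantumLattice

section Range

variable {μ : ℝ} (hμ₁ : -4 < μ) (hμ₂ : μ < -2 - Real.sqrt 2)
include hμ₁ hμ₂

/-! ### §1 Uniform bounds on the Fermi curve -/

/-- The Cartesian coordinates of the curve lie in the open box `|kᵢ| < π/4`:
`|u cos θ| < π/4`, `|u sin θ| < π/4`. [folklore] -/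
theorem abs_fermiRadius_mul_cos_lt (θ : ℝ) : |fermiRadius μ θ * Real.cos θ| < π / 4 := by
  simpa [dir] using abs_fermiRadius_mul_dir_lt hμ₁ hμ₂ θ 0

/-- Companion of `abs_fermiRadius_mul_cos_lt`. [folklore] -/
theorem abs_fermiRadius_mul_sin_lt (θ : ℝ) : |fermiRadius μ θ * Real.sin θ| < π / 4 := by
  simpa [dir] using abs_fermiRadius_mul_dir_lt hμ₁ hμ₂ θ 1

/-- `u(θ)² < π²/8`. [folklore] -/
theorem fermiRadius_sq_lt (θ : ℝ) : fermiRadius μ θ ^ 2 < π ^ 2 / 8 := by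
  have h0 := abs_fermiRadius_mul_cos_lt hμ₁ hμ₂ θ
  have h1 := abs_fermiRadius_mul_sin_lt hμ₁ hμ₂ θ
  have h0' : (fermiRadius μ θ * Real.cos θ) ^ 2 < (π / 4) ^ 2 := by
    rw [← sq_abs]; exact pow_lt_pow_left₀ h0 (abs_nonneg _) two_ne_zero
  have h1' : (fermiRadius μ θ * Real.sin θ) ^ 2 < (π / 4) ^ 2 := by
    rw [← sq_abs]; exact pow_lt_pow_left₀ h1 (abs_nonneg _) two_ne_zero
  have hsc := Real.sin_sq_add_cos_sq θ
  nlinarith [hsc]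

/-- **`u ≥ c > 0` uniformly**: `μ + 4 ≤ u(θ)²` (from `ε(k) + 4 ≤ |k|²`). [cite: BenfattoGiulianiMastropietro2003, §2 (2.8a)] -/
theorem add_four_le_fermiRadius_sq (θ : ℝ) : μ + 4 ≤ fermiRadius μ θ ^ 2 := by
  have h := sqDispersion_add_four_le (fermiRadius μ θ • dir θ)
  rw [sqDispersion_fermiRadius hμ₁ hμ₂] at h
  have hsc := Real.sin_sq_add_cos_sq θ
  simp only [Pi.smul_apply, smul_eq_mul, dir, Matrix.cons_val_zero, Matrix.cons_val_one] at h
  nlinarith [h, hsc]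

/-- `√(μ+4) ≤ u(θ)`. [folklore] -/
theorem sqrt_le_fermiRadius (θ : ℝ) : Real.sqrt (μ + 4) ≤ fermiRadius μ θ :=
  (Real.sqrt_le_sqrt (add_four_le_fermiRadius_sq hμ₁ hμ₂ θ)).trans_eq
    (Real.sqrt_sq (fermiRadius_pos hμ₁ hμ₂ θ).le)

/-- The coordinates have absolute value at most `π/2` (the hypothesis of the radial-derivative
bounds). [folklore] -/
theorem abs_fermiPoint_le (θ : ℝ) (i : Fin 2) : |(fermiRadius μ θ • dir θ) i| ≤ π / 2 := by
  have := (abs_fermiRadius_mul_dir_lt hμ₁ hμ₂ θ i).le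
  simp only [Pi.smul_apply, smul_eq_mul]
  linarith [Real.pi_pos]

/-- **(2.8b), lower bound in radial form**: `(4/π)(μ+4) ≤ ∇ε(k)·k` on the Fermi curve. [cite: BenfattoGiulianiMastropietro2003, §2 (2.8b)] -/
theorem le_radialDeriv_fermi (θ : ℝ) : 4 / π * (μ + 4) ≤ radialDeriv (fermiRadius μ θ • dir θ) :=
  le_radialDeriv_of_sqDispersion_eq (abs_fermiPoint_le hμ₁ hμ₂ θ) (sqDispersion_fermiRadius hμ₁ hμ₂ θ)

/-- `∇ε(k)·k > 0` on the Fermi curve. [folklore] -/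
theorem radialDeriv_fermi_pos (θ : ℝ) : 0 < radialDeriv (fermiRadius μ θ • dir θ) :=
  radialDeriv_pos_of_sqDispersion_eq hμ₁ (abs_fermiPoint_le hμ₁ hμ₂ θ) (sqDispersion_fermiRadius hμ₁ hμ₂ θ)

omit hμ₁ hμ₂ in
/-- `a sin a ≤ a²`. [folklore] -/
theorem mul_sin_le_sq (a : ℝ) : a * Real.sin a ≤ a ^ 2 := by
  rcases le_total 0 a with ha | ha
  · have := Real.sin_le ha
    nlinarith
  · have h := Real.sin_le (neg_nonneg.2 ha)
    rw [Real.sin_neg] at h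
    nlinarith

omit hμ₁ hμ₂ in
/-- **Upper bound** `∇ε(k)·k ≤ 2|k|²`, here `≤ 2u²`. [folklore] -/
theorem radialDeriv_smul_dir_le (t θ : ℝ) : radialDeriv (t • dir θ) ≤ 2 * t ^ 2 := by
  have h0 := mul_sin_le_sq (t * Real.cos θ)
  have h1 := mul_sin_le_sq (t * Real.sin θ)
  have hsc := Real.sin_sq_add_cos_sq θ
  simp only [radialDeriv, Pi.smul_apply, smul_eq_mul, dir, Matrix.cons_val_zero, Matrix.cons_val_one]
  nlinarith [h0, h1, hsc]

/-- **(2.8b) as printed: `0 < c₁ ≤ ∇ε(p_F(θ))·e_r(θ) ≤ c₂`** with `c₁ = (4/π)(μ+4)·(4/(π√2))`… we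
state it with the radius divided out: `(4/π)(μ+4)/u(θ) ≤ ∇ε·e_r = (∇ε·k)/u ≤ 2u(θ)`, and `u` is
pinched between `√(μ+4)` and `π√2/4`. Here `∇ε·e_r` is written as `radialDeriv k / u`. [cite: BenfattoGiulianiMastropietro2003, §2 (2.8b)] -/
theorem le_grad_dot_dir (θ : ℝ) :
    4 / π * (μ + 4) / fermiRadius μ θ ≤ radialDeriv (fermiRadius μ θ • dir θ) / fermiRadius μ θ :=
  div_le_div_of_nonneg_right (le_radialDeriv_fermi hμ₁ hμ₂ θ) (fermiRadius_pos hμ₁ hμ₂ θ).le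

/-- Upper half of (2.8b): `∇ε·e_r ≤ 2u(θ)`. [cite: BenfattoGiulianiMastropietro2003, §2 (2.8b)] -/
theorem grad_dot_dir_le (θ : ℝ) :
    radialDeriv (fermiRadius μ θ • dir θ) / fermiRadius μ θ ≤ 2 * fermiRadius μ θ := by
  rw [div_le_iff₀ (fermiRadius_pos hμ₁ hμ₂ θ)]
  have := radialDeriv_smul_dir_le (fermiRadius μ θ) θ
  nlinarith [fermiRadius_pos hμ₁ hμ₂ θ]

/-- `∂_t F(θ, u) = (∇ε·k)/u`. [folklore] -/
theorem rayDispersionDt_fermiRadius_eq (θ : ℝ) :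
    rayDispersionDt θ (fermiRadius μ θ) = radialDeriv (fermiRadius μ θ • dir θ) / fermiRadius μ θ := by
  rw [eq_div_iff (fermiRadius_pos hμ₁ hμ₂ θ).ne', mul_comm, mul_rayDispersionDt]

omit hμ₁ hμ₂ in
/-- `|∂_θ F(θ, t)| ≤ 4t²` for `t ≥ 0` (`|sin a| ≤ |a|`). [folklore] -/
theorem abs_rayDispersionDθ_le {θ t : ℝ} (ht : 0 ≤ t) : |rayDispersionDθ θ t| ≤ 4 * t ^ 2 := by
  rw [rayDispersionDθ]
  have h1 : |Real.cos θ * Real.sin (t * Real.sin θ)| ≤ t := by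
    rw [abs_mul]
    calc |Real.cos θ| * |Real.sin (t * Real.sin θ)| ≤ 1 * |t * Real.sin θ| :=
          mul_le_mul (Real.abs_cos_le_one θ) (Real.abs_sin_le_abs) (abs_nonneg _) zero_le_one
      _ = t * |Real.sin θ| := by rw [one_mul, abs_mul, abs_of_nonneg ht]
      _ ≤ t * 1 := mul_le_mul_of_nonneg_left (Real.abs_sin_le_one θ) ht
      _ = t := mul_one t
  have h2 : |Real.sin θ * Real.sin (t * Real.cos θ)| ≤ t := by
    rw [abs_mul]
    calc |Real.sin θ| * |Real.sin (t * Real.cos θ)| ≤ 1 * |t * Real.cos θ| :=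
          mul_le_mul (Real.abs_sin_le_one θ) (Real.abs_sin_le_abs) (abs_nonneg _) zero_le_one
      _ = t * |Real.cos θ| := by rw [one_mul, abs_mul, abs_of_nonneg ht]
      _ ≤ t * 1 := mul_le_mul_of_nonneg_left (Real.abs_cos_le_one θ) ht
      _ = t := mul_one t
  have h3 : |Real.cos θ * Real.sin (t * Real.sin θ) - Real.sin θ * Real.sin (t * Real.cos θ)| ≤ 2 * t :=
    (abs_sub _ _).trans (by linarith)
  rw [abs_mul, abs_mul, abs_of_nonneg (by norm_num : (0 : ℝ) ≤ 2), abs_of_nonneg ht]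
  nlinarith [h3, abs_nonneg (Real.cos θ * Real.sin (t * Real.sin θ) - Real.sin θ * Real.sin (t * Real.cos θ))]

/-- **`|u'(θ)| ≤ π u(θ)³/(μ+4)`**: the Fermi radius has uniformly bounded derivative
(`u' = -∂_θF/∂_tF`, `|∂_θF| ≤ 4u²`, `∂_tF = (∇ε·k)/u ≥ (4/π)(μ+4)/u`). [folklore] -/
theorem abs_fermiRadiusDeriv_le (θ : ℝ) :
    |fermiRadiusDeriv μ θ| ≤ π * fermiRadius μ θ ^ 3 / (μ + 4) := by
  have hu := fermiRadius_pos hμ₁ hμ₂ θ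
  have hμ4 : 0 < μ + 4 := by linarith
  have hDt := rayDispersionDt_fermiRadius_pos hμ₁ hμ₂ θ
  have hDt' : 4 / π * (μ + 4) / fermiRadius μ θ ≤ rayDispersionDt θ (fermiRadius μ θ) := by
    rw [rayDispersionDt_fermiRadius_eq hμ₁ hμ₂]; exact le_grad_dot_dir hμ₁ hμ₂ θ
  have hDθ := abs_rayDispersionDθ_le (θ := θ) hu.le
  rw [fermiRadiusDeriv, abs_div, abs_neg, abs_of_pos hDt, div_le_div_iff₀ hDt hμ4]
  have hlow : 0 < 4 / π * (μ + 4) / fermiRadius μ θ := by positivity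
  calc |rayDispersionDθ θ (fermiRadius μ θ)| * (μ + 4)
      ≤ 4 * fermiRadius μ θ ^ 2 * (μ + 4) := mul_le_mul_of_nonneg_right hDθ hμ4.le
    _ = π * fermiRadius μ θ ^ 3 * (4 / π * (μ + 4) / fermiRadius μ θ) := by
        field_simp
    _ ≤ π * fermiRadius μ θ ^ 3 * rayDispersionDt θ (fermiRadius μ θ) :=
        mul_le_mul_of_nonneg_left hDt' (by positivity)

omit hμ₁ hμ₂ in
/-- **The region enclosed by the Fermi curve is convex**: the sublevel set `{ε ≤ μ}` inside the
box `[-π/2, π/2]²` (which contains the curve and the origin) is convex, `ε` being strictly convex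
there (`strictConvexOn_sqDispersion`). BGM 2006 §1: "a smooth convex closed curve". [cite: BenfattoGiulianiMastropietro2006, §1 (1.4)-(1.5)] -/
theorem convex_fermiRegion (μ' : ℝ) : Convex ℝ {k ∈ halfBox | sqDispersion k ≤ μ'} :=
  strictConvexOn_sqDispersion.convexOn.convex_le μ'

/-! ### §2 The second derivative of the Fermi radius -/

/-- `u'` is smooth (`C^∞`). [folklore] -/
theorem contDiff_fermiRadiusDeriv : ContDiff ℝ ∞ (fermiRadiusDeriv μ) := by
  have h : ContDiff ℝ ∞ (deriv^[1] (fermiRadius μ)) :=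
    ContDiff.iterate_deriv 1 (contDiff_fermiRadius hμ₁ hμ₂ (μ := μ) (n := ∞))
  have hfun : deriv (fermiRadius μ) = fermiRadiusDeriv μ := funext (deriv_fermiRadius hμ₁ hμ₂)
  rwa [Function.iterate_one, hfun] at h

omit hμ₁ hμ₂ in
/-- The second derivative `u''(θ)` of the Fermi radius. [folklore] -/
def fermiRadiusDeriv2 (μ θ : ℝ) : ℝ := deriv (fermiRadiusDeriv μ) θ

/-- `u'` has derivative `u''`. [folklore] -/
theorem hasDerivAt_fermiRadiusDeriv (θ : ℝ) :
    HasDerivAt (fermiRadiusDeriv μ) (fermiRadiusDeriv2 μ θ) θ :=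
  ((contDiff_fermiRadiusDeriv hμ₁ hμ₂).differentiable (by simp) θ).hasDerivAt

/-! ### §3 The Cartesian parametrisation `p(θ) = (u cos θ, u sin θ)` and its derivatives -/

omit hμ₁ hμ₂ in
/-- `x(θ) = u(θ) cos θ`. [folklore] -/
def fermiX (μ θ : ℝ) : ℝ := fermiRadius μ θ * Real.cos θ

omit hμ₁ hμ₂ in
/-- `y(θ) = u(θ) sin θ`. [folklore] -/
def fermiY (μ θ : ℝ) : ℝ := fermiRadius μ θ * Real.sin θ

omit hμ₁ hμ₂ in
/-- `x'(θ) = u' cos θ - u sin θ`. [folklore] -/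
def fermiVX (μ θ : ℝ) : ℝ := fermiRadiusDeriv μ θ * Real.cos θ - fermiRadius μ θ * Real.sin θ

omit hμ₁ hμ₂ in
/-- `y'(θ) = u' sin θ + u cos θ`. [folklore] -/
def fermiVY (μ θ : ℝ) : ℝ := fermiRadiusDeriv μ θ * Real.sin θ + fermiRadius μ θ * Real.cos θ

omit hμ₁ hμ₂ in
/-- `x''(θ) = u'' cos θ - 2u' sin θ - u cos θ`. [folklore] -/
def fermiAX (μ θ : ℝ) : ℝ :=
  fermiRadiusDeriv2 μ θ * Real.cos θ - 2 * fermiRadiusDeriv μ θ * Real.sin θ - fermiRadius μ θ * Real.cos θ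

omit hμ₁ hμ₂ in
/-- `y''(θ) = u'' sin θ + 2u' cos θ - u sin θ`. [folklore] -/
def fermiAY (μ θ : ℝ) : ℝ :=
  fermiRadiusDeriv2 μ θ * Real.sin θ + 2 * fermiRadiusDeriv μ θ * Real.cos θ - fermiRadius μ θ * Real.sin θ

omit hμ₁ hμ₂ in
/-- The curve in the tree's vector form: `(x, y) = u · dir θ`. [folklore] -/
theorem fermiRadius_smul_dir_eq (μ θ : ℝ) : fermiRadius μ θ • dir θ = ![fermiX μ θ, fermiY μ θ] := by
  ext i
  fin_cases i <;> simp [dir, fermiX, fermiY]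

/-- The curve lies on the level set: `-2(cos x + cos y) = μ`. [folklore] -/
theorem sqDispersion_fermiXY (θ : ℝ) : -2 * (Real.cos (fermiX μ θ) + Real.cos (fermiY μ θ)) = μ := by
  have h := sqDispersion_fermiRadius hμ₁ hμ₂ θ
  rw [fermiRadius_smul_dir_eq] at h
  simpa [sqDispersion] using h

/-- `x` has derivative `x'`. [folklore] -/
theorem hasDerivAt_fermiX (θ : ℝ) : HasDerivAt (fermiX μ) (fermiVX μ θ) θ := by
  have h := (hasDerivAt_fermiRadius hμ₁ hμ₂ θ).mul (Real.hasDerivAt_cos θ)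
  refine h.congr_deriv ?_
  unfold fermiVX
  ring

/-- `y` has derivative `y'`. [folklore] -/
theorem hasDerivAt_fermiY (θ : ℝ) : HasDerivAt (fermiY μ) (fermiVY μ θ) θ := by
  have h := (hasDerivAt_fermiRadius hμ₁ hμ₂ θ).mul (Real.hasDerivAt_sin θ)
  refine h.congr_deriv ?_
  unfold fermiVY
  ring

/-- `x'` has derivative `x''`. [folklore] -/
theorem hasDerivAt_fermiVX (θ : ℝ) : HasDerivAt (fermiVX μ) (fermiAX μ θ) θ := by
  have h := ((hasDerivAt_fermiRadiusDeriv hμ₁ hμ₂ θ).mul (Real.hasDerivAt_cos θ)).sub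
    ((hasDerivAt_fermiRadius hμ₁ hμ₂ θ).mul (Real.hasDerivAt_sin θ))
  refine h.congr_deriv ?_
  unfold fermiAX
  ring

/-- `y'` has derivative `y''`. [folklore] -/
theorem hasDerivAt_fermiVY (θ : ℝ) : HasDerivAt (fermiVY μ) (fermiAY μ θ) θ := by
  have h := ((hasDerivAt_fermiRadiusDeriv hμ₁ hμ₂ θ).mul (Real.hasDerivAt_sin θ)).add
    ((hasDerivAt_fermiRadius hμ₁ hμ₂ θ).mul (Real.hasDerivAt_cos θ))
  refine h.congr_deriv ?_
  unfold fermiAY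
  ring

omit hμ₁ hμ₂ in
/-- `|p'|² = u² + u'²` (BGM 2003 (A1.6): `s' = √(u'² + u²)`). [cite: BenfattoGiulianiMastropietro2003, §7.1 (A1.6)] -/
theorem fermiVX_sq_add_fermiVY_sq (μ θ : ℝ) :
    fermiVX μ θ ^ 2 + fermiVY μ θ ^ 2 = fermiRadius μ θ ^ 2 + fermiRadiusDeriv μ θ ^ 2 := by
  have hsc := Real.sin_sq_add_cos_sq θ
  simp only [fermiVX, fermiVY]
  nlinarith [hsc]

omit hμ₁ hμ₂ in
/-- `(y', -x')·p = u²` (the rotated velocity has radial component `u²`). [folklore] -/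
theorem fermiVY_mul_fermiX_sub (μ θ : ℝ) :
    fermiVY μ θ * fermiX μ θ - fermiVX μ θ * fermiY μ θ = fermiRadius μ θ ^ 2 := by
  have hsc := Real.sin_sq_add_cos_sq θ
  simp only [fermiVX, fermiVY, fermiX, fermiY]
  nlinarith [hsc]

omit hμ₁ hμ₂ in
/-- `½∇ε(p)·p = ½ radialDeriv p = x sin x + y sin y`. [folklore] -/
theorem radialDeriv_fermiXY (μ θ : ℝ) :
    radialDeriv (fermiRadius μ θ • dir θ) =
      2 * (fermiX μ θ * Real.sin (fermiX μ θ) + fermiY μ θ * Real.sin (fermiY μ θ)) := by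
  rw [fermiRadius_smul_dir_eq]
  simp [radialDeriv]

/-- **Tangency** `½∇ε(p)·p' = sin x · x' + sin y · y' = 0` (differentiate `ε(p(θ)) = μ`). [cite: BenfattoGiulianiMastropietro2003, §7.1 (A1.17)] -/
theorem sin_mul_fermiVX_add (θ : ℝ) :
    Real.sin (fermiX μ θ) * fermiVX μ θ + Real.sin (fermiY μ θ) * fermiVY μ θ = 0 := by
  -- `θ ↦ -2(cos x + cos y)` is the constant `μ`; compare its two derivatives
  have h1 : HasDerivAt (fun ϑ => -2 * (Real.cos (fermiX μ ϑ) + Real.cos (fermiY μ ϑ)))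
      (-2 * (-Real.sin (fermiX μ θ) * fermiVX μ θ + -Real.sin (fermiY μ θ) * fermiVY μ θ)) θ :=
    ((hasDerivAt_fermiX hμ₁ hμ₂ θ).cos.add (hasDerivAt_fermiY hμ₁ hμ₂ θ).cos).const_mul (-2)
  have h2 : HasDerivAt (fun ϑ => -2 * (Real.cos (fermiX μ ϑ) + Real.cos (fermiY μ ϑ))) 0 θ := by
    have : (fun ϑ => -2 * (Real.cos (fermiX μ ϑ) + Real.cos (fermiY μ ϑ))) = fun _ => μ :=
      funext (sqDispersion_fermiXY hμ₁ hμ₂)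
    rw [this]; exact hasDerivAt_const θ μ
  have := h1.unique h2
  linarith

/-- **Second-order identity** `Hess ε(p)(p',p') + ∇ε(p)·p'' = 0` in coordinates:
`cos x · x'² + sin x · x'' + cos y · y'² + sin y · y'' = 0` (differentiate the tangency identity,
which holds identically in `θ`). [cite: BenfattoGiulianiMastropietro2003, §7.1 (A1.7)] -/
theorem hess_add_grad_dot_acc (θ : ℝ) :
    Real.cos (fermiX μ θ) * fermiVX μ θ ^ 2 + Real.sin (fermiX μ θ) * fermiAX μ θ +
      (Real.cos (fermiY μ θ) * fermiVY μ θ ^ 2 + Real.sin (fermiY μ θ) * fermiAY μ θ) = 0 := by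
  have h1 : HasDerivAt (fun ϑ => Real.sin (fermiX μ ϑ) * fermiVX μ ϑ + Real.sin (fermiY μ ϑ) * fermiVY μ ϑ)
      ((Real.cos (fermiX μ θ) * fermiVX μ θ) * fermiVX μ θ + Real.sin (fermiX μ θ) * fermiAX μ θ +
        ((Real.cos (fermiY μ θ) * fermiVY μ θ) * fermiVY μ θ + Real.sin (fermiY μ θ) * fermiAY μ θ)) θ :=
    ((hasDerivAt_fermiX hμ₁ hμ₂ θ).sin.mul (hasDerivAt_fermiVX hμ₁ hμ₂ θ)).add
      ((hasDerivAt_fermiY hμ₁ hμ₂ θ).sin.mul (hasDerivAt_fermiVY hμ₁ hμ₂ θ))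
  have h2 : HasDerivAt (fun ϑ => Real.sin (fermiX μ ϑ) * fermiVX μ ϑ + Real.sin (fermiY μ ϑ) * fermiVY μ ϑ) 0 θ := by
    have : (fun ϑ => Real.sin (fermiX μ ϑ) * fermiVX μ ϑ + Real.sin (fermiY μ ϑ) * fermiVY μ ϑ) = fun _ => 0 :=
      funext (sin_mul_fermiVX_add hμ₁ hμ₂)
    rw [this]; exact hasDerivAt_const θ (0 : ℝ)
  have := h1.unique h2
  nlinarith [this]

omit hμ₁ hμ₂ in
/-- The normal coefficient `c(θ) = (∇ε·k)/(2u²)` with `½∇ε(p) = c (y', -x')`. [folklore] -/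
def normalCoeff (μ θ : ℝ) : ℝ := radialDeriv (fermiRadius μ θ • dir θ) / (2 * fermiRadius μ θ ^ 2)

/-- `c(θ) > 0`. [folklore] -/
theorem normalCoeff_pos (θ : ℝ) : 0 < normalCoeff μ θ :=
  div_pos (radialDeriv_fermi_pos hμ₁ hμ₂ θ) (by have := fermiRadius_pos hμ₁ hμ₂ θ; positivity)

/-- **Normal form of the gradient**: `sin x = c y'` and `sin y = -c x'` with `c = (∇ε·k)/(2u²)`
(`∇ε ⊥ p'` in the plane, normalised through `(y',-x')·p = u²` and `½∇ε·p = ½∇ε·k`). BGM 2003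
(A1.17): `∇ε(p) = a(θ) n(θ)`, `a > 0`. [cite: BenfattoGiulianiMastropietro2003, §7.1 (A1.17)] -/
theorem sin_fermiX_eq (θ : ℝ) : Real.sin (fermiX μ θ) = normalCoeff μ θ * fermiVY μ θ := by
  have hT := sin_mul_fermiVX_add hμ₁ hμ₂ θ
  have hR := radialDeriv_fermiXY μ θ
  have hrot := fermiVY_mul_fermiX_sub μ θ
  have hu2 : fermiRadius μ θ ^ 2 ≠ 0 := by have := fermiRadius_pos hμ₁ hμ₂ θ; positivity
  have e1 : Real.sin (fermiX μ θ) * fermiRadius μ θ ^ 2 =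
      radialDeriv (fermiRadius μ θ • dir θ) / 2 * fermiVY μ θ := by
    rw [← hrot]
    linear_combination (-fermiY μ θ) * hT + (-(fermiVY μ θ) / 2) * hR
  have hu2' : (0 : ℝ) < 2 * fermiRadius μ θ ^ 2 := by have := fermiRadius_pos hμ₁ hμ₂ θ; positivity
  rw [normalCoeff, div_mul_eq_mul_div, eq_div_iff hu2'.ne']
  linear_combination 2 * e1

/-- Companion: `sin y = -c x'`. [cite: BenfattoGiulianiMastropietro2003, §7.1 (A1.17)] -/
theorem sin_fermiY_eq (θ : ℝ) : Real.sin (fermiY μ θ) = -(normalCoeff μ θ * fermiVX μ θ) := by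
  have hT := sin_mul_fermiVX_add hμ₁ hμ₂ θ
  have hR := radialDeriv_fermiXY μ θ
  have hrot := fermiVY_mul_fermiX_sub μ θ
  have hu2 : fermiRadius μ θ ^ 2 ≠ 0 := by have := fermiRadius_pos hμ₁ hμ₂ θ; positivity
  have e2 : Real.sin (fermiY μ θ) * fermiRadius μ θ ^ 2 =
      -(radialDeriv (fermiRadius μ θ • dir θ) / 2 * fermiVX μ θ) := by
    rw [← hrot]
    linear_combination (fermiX μ θ) * hT + (fermiVX μ θ / 2) * hR
  have hu2' : (0 : ℝ) < 2 * fermiRadius μ θ ^ 2 := by have := fermiRadius_pos hμ₁ hμ₂ θ; positivity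
  rw [normalCoeff, div_mul_eq_mul_div, ← neg_div, eq_div_iff hu2'.ne']
  linear_combination 2 * e2

/-! ### §4 The curvature of the Fermi curve -/

omit hμ₁ hμ₂ in
/-- **The signed curvature** of the Fermi curve `θ ↦ (x, y) = u(θ)(cos θ, sin θ)` traversed
counterclockwise: `κ = (x'y'' - y'x'')/|p'|³`, `|p'|² = u² + u'²` — the reciprocal `1/r(θ)` of the
curvature radius of BGM 2003 (A1.7) (`p'' = s''τ - (s'²/r) n`). [cite: BenfattoGiulianiMastropietro2003, §7.1 (A1.7)] -/
def fermiCurvature (μ θ : ℝ) : ℝ :=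
  (fermiVX μ θ * fermiAY μ θ - fermiVY μ θ * fermiAX μ θ) /
    ((fermiRadius μ θ ^ 2 + fermiRadiusDeriv μ θ ^ 2) *
      Real.sqrt (fermiRadius μ θ ^ 2 + fermiRadiusDeriv μ θ ^ 2))

/-- **The level-set formula for the curvature numerator**:
`c · (x'y'' - y'x'') = cos x · x'² + cos y · y'²`, i.e. `x'y'' - y'x'' = Hess ε(p',p')·u²/(∇ε·k)`
(second-order identity + normal form of the gradient). [cite: BenfattoGiulianiMastropietro2003, §7.1 (A1.7)] -/
theorem normalCoeff_mul_cross (θ : ℝ) :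
    normalCoeff μ θ * (fermiVX μ θ * fermiAY μ θ - fermiVY μ θ * fermiAX μ θ) =
      Real.cos (fermiX μ θ) * fermiVX μ θ ^ 2 + Real.cos (fermiY μ θ) * fermiVY μ θ ^ 2 := by
  have hE := hess_add_grad_dot_acc hμ₁ hμ₂ θ
  rw [sin_fermiX_eq hμ₁ hμ₂, sin_fermiY_eq hμ₁ hμ₂] at hE
  linear_combination -hE

/-- `cos x > √2/2` on the curve (the box `|x| < π/4`). [folklore] -/
theorem sqrt_two_div_two_lt_cos_fermiX (θ : ℝ) : Real.sqrt 2 / 2 < Real.cos (fermiX μ θ) := by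
  have h := abs_fermiRadius_mul_cos_lt hμ₁ hμ₂ θ
  rw [← Real.cos_pi_div_four, ← Real.cos_abs (fermiX μ θ)]
  exact Real.cos_lt_cos_of_nonneg_of_le_pi (abs_nonneg _) (by linarith [Real.pi_pos]) h

/-- `cos y > √2/2` on the curve. [folklore] -/
theorem sqrt_two_div_two_lt_cos_fermiY (θ : ℝ) : Real.sqrt 2 / 2 < Real.cos (fermiY μ θ) := by
  have h := abs_fermiRadius_mul_sin_lt hμ₁ hμ₂ θ
  rw [← Real.cos_pi_div_four, ← Real.cos_abs (fermiY μ θ)]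
  exact Real.cos_lt_cos_of_nonneg_of_le_pi (abs_nonneg _) (by linarith [Real.pi_pos]) h

/-- **Strong convexity of the dispersion on the curve**:
`Hess ε(p)(p',p')/2 = cos x · x'² + cos y · y'² ≥ (√2/2)|p'|²`. [folklore] -/
theorem hess_fermi_ge (θ : ℝ) :
    Real.sqrt 2 / 2 * (fermiRadius μ θ ^ 2 + fermiRadiusDeriv μ θ ^ 2) ≤
      Real.cos (fermiX μ θ) * fermiVX μ θ ^ 2 + Real.cos (fermiY μ θ) * fermiVY μ θ ^ 2 := by
  rw [← fermiVX_sq_add_fermiVY_sq, mul_add]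
  exact add_le_add
    (mul_le_mul_of_nonneg_right (sqrt_two_div_two_lt_cos_fermiX hμ₁ hμ₂ θ).le (sq_nonneg _))
    (mul_le_mul_of_nonneg_right (sqrt_two_div_two_lt_cos_fermiY hμ₁ hμ₂ θ).le (sq_nonneg _))

omit hμ₁ hμ₂ in
/-- Upper Hessian bound `cos x · x'² + cos y · y'² ≤ |p'|²`. [folklore] -/
theorem hess_fermi_le (θ : ℝ) :
    Real.cos (fermiX μ θ) * fermiVX μ θ ^ 2 + Real.cos (fermiY μ θ) * fermiVY μ θ ^ 2 ≤
      fermiRadius μ θ ^ 2 + fermiRadiusDeriv μ θ ^ 2 := by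
  rw [← fermiVX_sq_add_fermiVY_sq]
  nlinarith [Real.cos_le_one (fermiX μ θ), Real.cos_le_one (fermiY μ θ), sq_nonneg (fermiVX μ θ),
    sq_nonneg (fermiVY μ θ)]

/-- `c ≤ 1` (from `∇ε·k ≤ 2|k|²`). [folklore] -/
theorem normalCoeff_le_one (θ : ℝ) : normalCoeff μ θ ≤ 1 := by
  have hu := fermiRadius_pos hμ₁ hμ₂ θ
  rw [normalCoeff, div_le_one (by positivity)]
  exact radialDeriv_smul_dir_le _ _

/-- `c ≥ 16(μ+4)/π³` (from `∇ε·k ≥ (4/π)(μ+4)` and `u² < π²/8`). [folklore] -/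
theorem le_normalCoeff (θ : ℝ) : 16 * (μ + 4) / π ^ 3 ≤ normalCoeff μ θ := by
  have hu := fermiRadius_pos hμ₁ hμ₂ θ
  have hR := le_radialDeriv_fermi hμ₁ hμ₂ θ
  have hU := fermiRadius_sq_lt hμ₁ hμ₂ θ
  have hμ4 : 0 < μ + 4 := by linarith
  rw [normalCoeff, div_le_div_iff₀ (by positivity) (by positivity)]
  have hπ := Real.pi_pos
  have h1 : 4 / π * (μ + 4) * π ^ 3 = 4 * (μ + 4) * π ^ 2 := by field_simp
  calc 16 * (μ + 4) * (2 * fermiRadius μ θ ^ 2) ≤ 16 * (μ + 4) * (2 * (π ^ 2 / 8)) := by gcongr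
    _ = 4 / π * (μ + 4) * π ^ 3 := by rw [h1]; ring
    _ ≤ radialDeriv (fermiRadius μ θ • dir θ) * π ^ 3 := by gcongr

/-- **The Fermi curve is strictly convex: `κ(θ) > 0`.** [cite: BenfattoGiulianiMastropietro2003, §2 (2.8a)] -/
theorem fermiCurvature_pos (θ : ℝ) : 0 < fermiCurvature μ θ := by
  have hu := fermiRadius_pos hμ₁ hμ₂ θ
  have hs2 : 0 < fermiRadius μ θ ^ 2 + fermiRadiusDeriv μ θ ^ 2 := by positivity
  have hc := normalCoeff_pos hμ₁ hμ₂ θ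
  have hN : 0 < Real.cos (fermiX μ θ) * fermiVX μ θ ^ 2 + Real.cos (fermiY μ θ) * fermiVY μ θ ^ 2 :=
    lt_of_lt_of_le (by positivity) (hess_fermi_ge hμ₁ hμ₂ θ)
  have hcross : 0 < fermiVX μ θ * fermiAY μ θ - fermiVY μ θ * fermiAX μ θ := by
    have h := normalCoeff_mul_cross hμ₁ hμ₂ θ
    rw [← h] at hN
    exact pos_of_mul_pos_right hN hc.le
  exact div_pos hcross (by positivity)

/-- **(2.8a) for the Hubbard dispersion at BGM 2006's fillings — the curvature of the Fermi curve is
bounded above and below by positive constants, uniformly in the angle**: for `-4 < μ < -2 - √2`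
there are `0 < c₁ ≤ c₂` with `c₁ ≤ κ(θ) ≤ c₂` for all `θ` (explicitly
`c₁ = (√2/2)/√(π²/8 + (4π³/(μ+4))²)`, `c₂ = π³/(16(μ+4)√(μ+4))`). [cite: BenfattoGiulianiMastropietro2003, §2 (2.8a)] -/
theorem exists_fermiCurvature_bounds :
    ∃ c₁ c₂ : ℝ, 0 < c₁ ∧ c₁ ≤ c₂ ∧ ∀ θ : ℝ, c₁ ≤ fermiCurvature μ θ ∧ fermiCurvature μ θ ≤ c₂ := by
  have hμ4 : 0 < μ + 4 := by linarith
  have hπ := Real.pi_pos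
  -- uniform bounds: `|p'|² ≤ K`, `c ≥ cmin`, `|p'| ≥ √(μ+4)`
  set K : ℝ := π ^ 2 / 8 + (4 * π ^ 3 / (μ + 4)) ^ 2 with hK
  have hKpos : 0 < K := by positivity
  set cmin : ℝ := 16 * (μ + 4) / π ^ 3 with hcmin
  have hcmin : 0 < cmin := by positivity
  set c₁ : ℝ := Real.sqrt 2 / 2 / Real.sqrt K with hc₁
  set c₂ : ℝ := 1 / (cmin * Real.sqrt (μ + 4)) with hc₂
  have hc₁pos : 0 < c₁ := by positivity
  have hbounds : ∀ θ : ℝ, c₁ ≤ fermiCurvature μ θ ∧ fermiCurvature μ θ ≤ c₂ := by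
    intro θ
    have hu := fermiRadius_pos hμ₁ hμ₂ θ
    set s2 := fermiRadius μ θ ^ 2 + fermiRadiusDeriv μ θ ^ 2 with hs2def
    have hs2 : 0 < s2 := by positivity
    have hc := normalCoeff_pos hμ₁ hμ₂ θ
    have hcle := normalCoeff_le_one hμ₁ hμ₂ θ
    have hcge : cmin ≤ normalCoeff μ θ := le_normalCoeff hμ₁ hμ₂ θ
    set N := Real.cos (fermiX μ θ) * fermiVX μ θ ^ 2 + Real.cos (fermiY μ θ) * fermiVY μ θ ^ 2 with hNdef
    have hNge : Real.sqrt 2 / 2 * s2 ≤ N := hess_fermi_ge hμ₁ hμ₂ θ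
    have hNle : N ≤ s2 := hess_fermi_le θ
    -- `s2 ≤ K`
    have hU2 := fermiRadius_sq_lt hμ₁ hμ₂ θ
    have hu' := abs_fermiRadiusDeriv_le hμ₁ hμ₂ θ
    have hu3 : fermiRadius μ θ ^ 3 ≤ 4 := by
      have hu1 : fermiRadius μ θ ^ 2 < 2 := by nlinarith [Real.pi_le_four]
      have hul : fermiRadius μ θ < 2 := by nlinarith
      nlinarith
    have hderiv : |fermiRadiusDeriv μ θ| ≤ 4 * π ^ 3 / (μ + 4) := by
      refine hu'.trans ?_
      rw [div_le_div_iff_of_pos_right hμ4]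
      have : π ≤ π ^ 3 := by nlinarith [Real.two_le_pi]
      nlinarith
    have hs2K : s2 ≤ K := by
      have h1 : fermiRadiusDeriv μ θ ^ 2 ≤ (4 * π ^ 3 / (μ + 4)) ^ 2 := by
        rw [← sq_abs]; exact pow_le_pow_left₀ (abs_nonneg _) hderiv 2
      rw [hs2def, hK]
      linarith
    -- the curvature as `N / (c s2 √s2)`
    have hκ : fermiCurvature μ θ = N / (normalCoeff μ θ * (s2 * Real.sqrt s2)) := by
      have hcross : fermiVX μ θ * fermiAY μ θ - fermiVY μ θ * fermiAX μ θ = N / normalCoeff μ θ := by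
        rw [eq_div_iff hc.ne', mul_comm, hNdef]
        exact normalCoeff_mul_cross hμ₁ hμ₂ θ
      rw [fermiCurvature, ← hs2def, hcross, div_div]
    have hsqrt_pos : 0 < Real.sqrt s2 := Real.sqrt_pos.2 hs2
    have hsqrt_le : Real.sqrt s2 ≤ Real.sqrt K := Real.sqrt_le_sqrt hs2K
    have hsqrt_ge : Real.sqrt (μ + 4) ≤ Real.sqrt s2 := by
      refine Real.sqrt_le_sqrt ?_
      rw [hs2def]
      nlinarith [add_four_le_fermiRadius_sq hμ₁ hμ₂ θ]
    constructor
    · -- lower bound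
      rw [hκ, le_div_iff₀ (by positivity), hc₁]
      calc Real.sqrt 2 / 2 / Real.sqrt K * (normalCoeff μ θ * (s2 * Real.sqrt s2))
          ≤ Real.sqrt 2 / 2 / Real.sqrt K * (1 * (s2 * Real.sqrt K)) := by gcongr
        _ = Real.sqrt 2 / 2 * s2 := by field_simp
        _ ≤ N := hNge
    · -- upper bound
      rw [hκ, div_le_iff₀ (by positivity), hc₂]
      calc N ≤ s2 := hNle
        _ = 1 / (cmin * Real.sqrt (μ + 4)) * (cmin * (s2 * Real.sqrt (μ + 4))) := by
            field_simp
        _ ≤ 1 / (cmin * Real.sqrt (μ + 4)) * (normalCoeff μ θ * (s2 * Real.sqrt s2)) := by gcongr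
  refine ⟨c₁, c₂, hc₁pos, ?_, hbounds⟩
  exact (hbounds 0).1.trans (hbounds 0).2

end Range

end Literature.MathematicalPhysics.QuantumLattice

end
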